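import Summits.BirchSwinnertonDyer.BirchSwinnertonDyer.Theorems.PrintX8SharpFlatRankZeroRoad
import Literature.NumberTheory.EllipticCurves.Sprung2012.SharpFlatSelmerModuleFiniteProofs
import HarnessLib

/-!
# Corner X8, analytic rank `0`, ANY image / conductor: the ♯/♭ main-conjecture road of
# `PrintX8SharpFlatRankZeroRoad.lean` WITHOUT Sprung 2012 Thm. 7.14 as a named input
# (cell `bsd-print-x8`, seat p1; companion file, `--supports stmt-BirchSwinnertonDyer-20313`)

PARTITION (D-0054(2)): corner X8 = K3 row A8 / W-ALL row 8, the cells `r_an = 0` (142 census rows,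
both 3-adic images); same class road as the parent file with ONE NAMED FACT FEWER; closes NONE; 0
census cells move; BSD is not proved by any of this. Beyond-print theorem: no.

The parent file displays Sprung 2012 Thm. 1.2 / 7.14 (`thm714_sharpFlatSelmerDual_finite_torsion`:
`X^•` finitely generated AND `Λ`-torsion when `L^• ≠ 0` — the torsion clause being Kato's theorem
through the ♯/♭ Coleman maps) only to feed Lemma 5.9's standing hypotheses. Both are available
WITHOUT that named fact: finite generation of EVERY chromatic Selmer dual is a tree THEOREM
(`Sprung2012.SharpFlatSelmerDualData.moduleFinite`, file `Sprung2012/SharpFlatSelmerModuleFiniteProofs`,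
Nakayama for Pontryagin duals, Greenberg LNM 1716 §1), and `Λ`-torsion of `X^•` is the FIRST CLAUSE
of Main Conjecture 7.21 as the obligation node states it (`Module.IsTorsion Λ D.X ∧ ∃ gen, …`). So the
rank-zero road rests on: BCDT (`exists_isNewformOf`), Sprung 2012 Thm. 2.2 (Honda system), Sprung 2024
Lemmas 5.5–5.9 (all `N`, flag `Sprung24-§5.2-allN-via-RaySprung25`), the period unit at `3`, GZK,
modularity — and the main conjecture. Primed variants of the parent's theorems.

References: [Sprung2024] Thm. 5.3 (p. 38), §5.2 (pp. 39–41); [Sprung2012] Thm. 1.2 (p. 1486), Thm. 2.2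
(p. 1487), Prop. 6.14, Main Conj. 7.21 (p. 1505); [GreenbergLNM1716] §1 p. 60; [Sprung2017] Thm. 1.12;
[Miller2011LMS] Def. 1.1.
-/

set_option autoImplicit false
-- justification: the mandated namespace `Summit.BirchSwinnertonDyer.BirchSwinnertonDyer.Theorems`
-- (single-conjunct summit, Sub = Summit) repeats a segment by design (D-0017).
set_option linter.dupNamespace false

noncomputable section


namespace Summit.BirchSwinnertonDyer.BirchSwinnertonDyer.Theorems.X8MainConjectureRoad

open scoped Classical NumberField MatrixGroups ModularForm
open NumberField IsDedekindDomain WeierstrassCurve CongruenceSubgroup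
  Literature.NumberTheory.EllipticCurves Literature.NumberTheory.EllipticCurves.ModularForms
  Literature.NumberTheory.EllipticCurves.Rank1Residual
  Literature.NumberTheory.EllipticCurves.Rank1Residual.Typed
  Literature.NumberTheory.EllipticCurves.Sprung2017 Literature.NumberTheory.EllipticCurves.Sprung2012
  Literature.NumberTheory.EllipticCurves.Sprung2024
  Literature.NumberTheory.EllipticCurves.ZpExtension
  Summit.BirchSwinnertonDyer.Rank1Residual.Supersingular

/-- **X8 ∧ `r_an = 0`, ANY image — Thm. 7.14-free form of `X8.bsdp_of_charIdeal_eq_of_analyticRank_eq_zero`.**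
Same statement with the named fact `h714` replaced by the torsion hypothesis `htorD` on the displayed
datum (the first clause of Main Conj. 7.21 at the pair) — finite generation being the tree theorem
`SharpFlatSelmerDualData.moduleFinite`. Granted BY NAME only Sprung 2024 Lemmas 5.5–5.9 (`h59`), the
period unit at `3` (`h3`), GZK, modularity. PER PAIR; conditional; closes nothing.
[cite: Sprung2024, Thm. 5.3 (p. 38) and §5.2 Lemmas 5.5–5.9, Proof of Thm. 5.3 (pp. 39–41)]
[cite: Sprung2012, Thm. 1.2 (p. 1486; finite generation) and Main Conj. 7.21 (p. 1505)]
[cite: GreenbergLNM1716, §1 p. 60] [cite: Miller2011LMS, Def. 1.1] -/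
theorem X8.bsdp_of_charIdeal_eq_of_analyticRank_eq_zero'
    (h59 : lem59AllN_sharpFlatCharValue_rankZero)
    (h3 : realPeriodRat_eq_unit_mul_plusPeriod_three)
    (hGZK : rank_eq_analyticRank_of_analyticRank_le_one) (hmod : hasEntireLFunction_rat)
    (W : WeierstrassCurve ℚ) [W.IsElliptic] [W.IsGloballyMinimal] (p : ℕ) [Fact p.Prime]
    (hX : ClassX8 W p) (h0 : W.analyticRank = 0)
    {κ : ZpExtension ℚ p} {γ : Field.absoluteGaloisGroup ℚ} (hκ : κ.IsCyclotomic)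
    (hγ : κ.IsTopGenerator γ) (hγ' : IsCyclotomicVariable p γ)
    {v : HeightOneSpectrum (𝓞 ℚ)} (hv : (p : 𝓞 ℚ) ∈ v.asIdeal)
    {g : Field.absoluteGaloisGroup (v.adicCompletion ℚ)}
    (hg : κ.IsTopGenerator (resGalOfEmb (closureEmb (K := ℚ) (v.adicCompletion ℚ)) g))
    {cneg : localPoints W (v.adicCompletion ℚ)} {c : ℕ → localPoints W (v.adicCompletion ℚ)}
    (hc : IsHondaSystem κ (closureEmb (K := ℚ) (v.adicCompletion ℚ)) W (W.frobeniusTrace p) g cneg c)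
    {N : ℕ} [NeZero N] {f : CuspForm (Gamma0 N) 2} (hf : IsNewformOf W f)
    {ϖ : ℚ} (hϖ : (ϖ : ℝ) * W.realPeriodRat = plusPeriod f)
    {Lsharp Lflat : IwasawaAlgebra p} (hSP : IsSprungPair f p (W.frobeniusTrace p) Lsharp Lflat)
    (col : Chroma)
    (D : SharpFlatSelmerDualData W κ γ (closureEmb (K := ℚ) (v.adicCompletion ℚ))
      (W.frobeniusTrace p) g c col)
    (htorD : Module.IsTorsion (IwasawaAlgebra p) D.X)
    (gen : IwasawaAlgebra p) (hchar : D.charIdeal = Ideal.span {gen})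
    (hι : iwasawaToPowerSeries p gen =
      PowerSeries.C (ϖ : ℚ_[p]) * iwasawaToPowerSeries p (chromaticL col Lsharp Lflat)) :
    BSDp W p := by
  have hp3 : p = 3 := hX.1
  subst hp3
  have hp2 : (3 : ℕ) ≠ 2 := by decide
  have hgood : W.HasGoodReductionAtPrime 3 := hX.2.1.1
  have hdvd : ((3 : ℕ) : ℤ) ∣ W.frobeniusTrace 3 := hX.2.1.2
  have hirr : W.HasIrreducibleModPGaloisRep 3 := ClassX8.irr W 3 hX
  have hL : W.entireLFunction 1 ≠ 0 := (W.analyticRank_eq_zero_iff_holds (hmod W)).1 h0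
  -- finite generation of `X^•` is a THEOREM (Nakayama for duals); torsion is displayed (`htorD`)
  haveI : Module.Finite (IwasawaAlgebra 3) D.X := SharpFlatSelmerDualData.moduleFinite hγ D
  -- (K•) by name (Sprung 2024 Lemmas 5.5–5.9, all levels)
  have hK : (⟨gen, 0, 0⟩ : SignedDatum W 3).EulerCharacteristic := fun hfin =>
    h59 W 3 hp2 hgood hdvd hL κ γ hκ hγ hγ' v hv g hg cneg c hc col D htorD gen hchar hfin
  -- `ϖ ∈ ℤ_3^×`, so `ι gen = ϖ · ι L^•` gives `(gen) = (L^•)`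
  have hϖ1 : ‖(ϖ : ℚ_[3])‖ = 1 := X8_norm_periodRatio_eq_one h3 W 3 hX hf hϖ
  obtain ⟨hspan', hι'⟩ := span_C_units_mul_eq (PadicInt.mkUnits hϖ1) (chromaticL col Lsharp Lflat)
  have hgen_eq : gen = PowerSeries.C ((PadicInt.mkUnits hϖ1 : ℤ_[3]ˣ) : ℤ_[3]) *
      chromaticL col Lsharp Lflat := by
    apply iwasawaToPowerSeries_injective 3
    rw [hι, hι', PadicInt.mkUnits_eq]
  have hspan : Ideal.span ({gen} : Set (IwasawaAlgebra 3)) =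
      Ideal.span {chromaticL col Lsharp Lflat} := by
    rw [hgen_eq, hspan']
  have hU : gen ∣ chromaticL col Lsharp Lflat :=
    (Ideal.span_singleton_eq_span_singleton.mp hspan).dvd
  exact (bsdp_iff_span_eq_span_chromaticL_of_analyticRank_eq_zero W 3 hGZK hp2 hgood hirr hL hf
    (h3 W hgood hirr f hf) hSP col (ClassX8.not_dvd_chromaticConst' W 3 hX col) gen hK hU).mpr hspan

/-- **X8 ∧ `r_an = 0`, ANY image, certificate shape — Thm. 7.14-free**: Main Conj. 7.21 for ONE
colour `•` with `L^• ≠ 0` (for the Sprung pair of some newform of `W`) gives `BSD(E,3)`, granted BY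
NAME Sprung 2012 Thm. 2.2 (`h22`, Honda system), Sprung 2024 Lemmas 5.5–5.9 (`h59`), the period unit
at `3` (`h3`), GZK, modularity — the torsion of `X^•` being read off the main conjecture itself and its
finite generation off `SharpFlatSelmerDualData.moduleFinite`. PER PAIR; conditional.
[cite: Sprung2024, §5.2 (pp. 39–41)] [cite: Sprung2012, Thm. 2.2 (p. 1487) and Main Conj. 7.21 (p. 1505)]
[cite: Miller2011LMS, Def. 1.1] -/
theorem X8.bsdp_of_sprungSharpFlatMainConjecture_col_of_analyticRank_eq_zero'
    (h22 : thm22_exists_isHondaSystem)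
    (h59 : lem59AllN_sharpFlatCharValue_rankZero)
    (h3 : realPeriodRat_eq_unit_mul_plusPeriod_three)
    (hGZK : rank_eq_analyticRank_of_analyticRank_le_one) (hmod : hasEntireLFunction_rat)
    (W : WeierstrassCurve ℚ) [W.IsElliptic] [W.IsGloballyMinimal] (p : ℕ) [Fact p.Prime]
    (hX : ClassX8 W p) (h0 : W.analyticRank = 0) (col : Chroma)
    {N : ℕ} [NeZero N] {f : CuspForm (Gamma0 N) 2} (hf : IsNewformOf W f)
    {Lsharp Lflat : IwasawaAlgebra p} (hSP : IsSprungPair f p (W.frobeniusTrace p) Lsharp Lflat)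
    (hcol : chromaticL col Lsharp Lflat ≠ 0)
    (hMC : SprungSharpFlatMainConjecture W p col) : BSDp W p := by
  have hp3 : p = 3 := hX.1
  subst hp3
  have hp2 : (3 : ℕ) ≠ 2 := by decide
  have hgood : W.HasGoodReductionAtPrime 3 := hX.2.1.1
  have hdvd : ((3 : ℕ) : ℤ) ∣ W.frobeniusTrace 3 := hX.2.1.2
  have hirr : W.HasIrreducibleModPGaloisRep 3 := ClassX8.irr W 3 hX
  obtain ⟨u, hu1, hΩu⟩ := h3 W hgood hirr f hf
  have hu0 : u ≠ 0 := by
    rintro rfl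
    rw [Rat.cast_zero, norm_zero] at hu1
    exact zero_ne_one hu1
  set ϖ : ℚ := u⁻¹ with hϖ_def
  have hϖ : (ϖ : ℝ) * W.realPeriodRat = plusPeriod f := by
    rw [hΩu, hϖ_def, Rat.cast_inv, ← mul_assoc, inv_mul_cancel₀ (Rat.cast_ne_zero.mpr hu0), one_mul]
  obtain ⟨κ, hκ, γ, hγ, hγ'⟩ := exists_isCyclotomic_isTopGenerator_isCyclotomicVariable_holds 3
  obtain ⟨v, hv⟩ :=
    Literature.NumberTheory.NumberFields.RingOfIntegers.exists_heightOneSpectrum_natCast_mem ℚ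
      (p := 3) (by norm_num)
  obtain ⟨g, hg⟩ := hκ.exists_isTopGenerator_resGalOfEmb_adicCompletion v hv
  obtain ⟨cneg, c, hc⟩ := h22 W 3 hp2 hgood hdvd κ γ hκ hγ hγ' v hv g hg
  let D := sharpFlatSelmerDualData W κ (closureEmb (K := ℚ) (v.adicCompletion ℚ))
    (W.frobeniusTrace 3) g c col hγ
  obtain ⟨htorD, gen, hchar, hι⟩ :=
    hMC κ γ hκ hγ hγ' v hv g hg cneg c hc N inferInstance f ϖ Lsharp Lflat hf hϖ hSP hcol D
  exact X8.bsdp_of_charIdeal_eq_of_analyticRank_eq_zero' h59 h3 hGZK hmod W 3 hX h0 hκ hγ hγ' hv hg hc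
    hf hϖ hSP col D htorD gen hchar hι

/-- **X8 ∧ `r_an = 0`, ANY image, ANY conductor — Thm. 7.14-free**: `∀ •, SprungSharpFlatMainConjecture
W 3 •` ⟹ `BSDp W 3`, granted BY NAME `exists_isNewformOf` (BCDT), Sprung 2012 Thm. 2.2, Sprung 2024
Lemmas 5.5–5.9 (all levels), the period unit at `3`, GZK and modularity — one named fact fewer than
`X8.bsdp_of_sprungSharpFlatMainConjecture_of_analyticRank_eq_zero`. Conditional; closes nothing.
[cite: Sprung2024, Thm. 5.3 (p. 38) and §5.2 (pp. 39–41)] [cite: Sprung2012, Thm. 2.2, Prop. 6.14 and Main Conj. 7.21]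
[cite: Sprung2017, Thm. 1.12] [cite: Miller2011LMS, Def. 1.1] -/
theorem X8.bsdp_of_sprungSharpFlatMainConjecture_of_analyticRank_eq_zero'
    (hmodf : exists_isNewformOf) (h22 : thm22_exists_isHondaSystem)
    (h59 : lem59AllN_sharpFlatCharValue_rankZero)
    (h3 : realPeriodRat_eq_unit_mul_plusPeriod_three)
    (hGZK : rank_eq_analyticRank_of_analyticRank_le_one) (hmod : hasEntireLFunction_rat)
    (W : WeierstrassCurve ℚ) [W.IsElliptic] [W.IsGloballyMinimal] (p : ℕ) [Fact p.Prime]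
    (hX : ClassX8 W p) (h0 : W.analyticRank = 0)
    (hMC : ∀ col : Chroma, SprungSharpFlatMainConjecture W p col) : BSDp W p := by
  have hp3 : p = 3 := hX.1
  subst hp3
  have hgood : W.HasGoodReductionAtPrime 3 := hX.2.1.1
  have hdvd : ((3 : ℕ) : ℤ) ∣ W.frobeniusTrace 3 := hX.2.1.2
  haveI : NeZero (W.conductorNorm ℤ) := ⟨(W.conductorNorm_pos_holds).ne'⟩
  obtain ⟨f, hf⟩ := hmodf W
  obtain ⟨Lsharp, Lflat, hSP⟩ :=
    thm112_exists_isSprungPair_holds (W := W) (f := f) (p := 3) (by decide) hf hgood hdvd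
  obtain ⟨col, hcol⟩ := hSP.exists_chromaticL_ne_zero hf hgood
  exact X8.bsdp_of_sprungSharpFlatMainConjecture_col_of_analyticRank_eq_zero' h22 h59 h3 hGZK hmod
    W 3 hX h0 col hf hSP hcol (hMC col)

/-- **Typed currency, Thm. 7.14-free**: X8 ∧ `r_an = 0`, any image: `∀ •, SprungSharpFlatMainConjecture
W 3 •` ⟹ `MissingPPartAt W 3`. [cite: Sprung2024, Thm. 5.3 (p. 38)] [cite: Miller2011LMS, Def. 1.1] -/
theorem X8.missingPPartAt_of_sprungSharpFlatMainConjecture_of_analyticRank_eq_zero'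
    (hmodf : exists_isNewformOf) (h22 : thm22_exists_isHondaSystem)
    (h59 : lem59AllN_sharpFlatCharValue_rankZero)
    (h3 : realPeriodRat_eq_unit_mul_plusPeriod_three)
    (hGZK : rank_eq_analyticRank_of_analyticRank_le_one) (hmod : hasEntireLFunction_rat)
    (W : WeierstrassCurve ℚ) [W.IsElliptic] [W.IsGloballyMinimal] (p : ℕ) [Fact p.Prime]
    (hX : ClassX8 W p) (h0 : W.analyticRank = 0)
    (hMC : ∀ col : Chroma, SprungSharpFlatMainConjecture W p col) : MissingPPartAt W p := by
  haveI : Finite W.sha := (hGZK W (by omega)).2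
  exact missingPPartAt_of_bsdp W p
    (X8.bsdp_of_sprungSharpFlatMainConjecture_of_analyticRank_eq_zero' hmodf h22 h59 h3 hGZK hmod
      W p hX h0 hMC)

/-- **Class form, Thm. 7.14-free**: «`∀` X8 pairs of analytic rank `0`, `∀ •`, Main Conj. 7.21» ⟹
«`∀` X8 pairs of analytic rank `0`, `MissingPPartAt W p`», granted BY NAME BCDT, Sprung 2012 Thm. 2.2,
Sprung 2024 Lemmas 5.5–5.9, the period unit at `3`, GZK, modularity. [cite: Sprung2024, Thm. 5.3 (p. 38) and §5.2 (pp. 39–41)]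
[cite: Sprung2012, Main Conj. 7.21 (p. 1505)] -/
theorem missingPPartAt_rankZero_of_mainConjecture'
    (hmodf : exists_isNewformOf) (h22 : thm22_exists_isHondaSystem)
    (h59 : lem59AllN_sharpFlatCharValue_rankZero)
    (h3 : realPeriodRat_eq_unit_mul_plusPeriod_three)
    (hGZK : rank_eq_analyticRank_of_analyticRank_le_one) (hmod : hasEntireLFunction_rat)
    (hMC : ∀ (W : WeierstrassCurve ℚ) [W.IsElliptic] [W.IsGloballyMinimal] (p : ℕ) [Fact p.Prime],
      ClassX8 W p → W.analyticRank = 0 → ∀ col : Chroma, SprungSharpFlatMainConjecture W p col) :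
    ∀ (W : WeierstrassCurve ℚ) [W.IsElliptic] [W.IsGloballyMinimal] (p : ℕ) [Fact p.Prime],
      ClassX8 W p → W.analyticRank = 0 → MissingPPartAt W p :=
  fun W _ _ p _ hX h0 =>
    X8.missingPPartAt_of_sprungSharpFlatMainConjecture_of_analyticRank_eq_zero' hmodf h22 h59 h3
      hGZK hmod W p hX h0 (hMC W p hX h0)

end Summit.BirchSwinnertonDyer.BirchSwinnertonDyer.Theorems.X8MainConjectureRoad

end
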